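import Literature.MathematicalPhysics.QuantumFieldTheory.Balaban1983to89.B8SockLettersRDEmptyTowerInhabited
import Literature.MathematicalPhysics.QuantumFieldTheory.Balaban1983to89.B8IdxB8LamTopTowerDisjoint

/-!
# `Balaban1983to89.B8SockLettersRDEmptyTowerClassUniform` — the BINDER-SHAPED strengthening of dag-n05-w2's `B8SockLettersRDEmptyTowerInhabited`: ON THE WHOLE EMPTY-TOWER
# SUB-CLASS `Ω = (ℤᵈ, ∅, ∅, …)` — EVERY spacing `η`, EVERY depth `k`, every truncation `n ≤ k`, every unitary background — [Balaban1985BackgroundPropagators]'s letter package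
# `B8SockLettersRD.SockLettersRD` HOLDS WITH ONE MEMBER-FREE CONSTANT VECTOR `(B_G, B_R, B₀′_H, B₂′) = (2, 0, 2, 4d)`, by the `η`-RESCALED degenerate witness

statement-level skeleton of published theorems with citation tags; proofs where landed; nothing here is a claim about the Yang–Mills mass gap

T. Bałaban, *Spaces of regular gauge field configurations on a lattice and gauge fixing conditions*, Commun. Math. Phys. **99** (1985) 75–102 `[Balaban1985RegularSpaces]`
("B8"): (1.3)–(1.6) p. 77, p. 77 («we admit the case where some domains Ω_j are equal to T_η»), (1.91)–(1.92) p. 91, (1.95)–(1.98) p. 92, (1.101) p. 93, (1.107) p. 94.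
T. Bałaban, *Propagators for lattice gauge theories in a background field*, Commun. Math. Phys. **99** (1985) 389–434 `[Balaban1985BackgroundPropagators]` ("[4]"): Thm 3.1 p. 397,
(3.16) p. 393, (3.23)–(3.25) p. 394.

## WHY THIS FILE (cell `pub-ymgap`, HUMAN RULING D-0062; width seat `pub-ymgap-dag-n05-w1` g3, DAG node N05 = [B8]; proof lane, count-neutral)

The N05 slot's [4]-letters binder is a `∀` OVER MEMBERS with ONE constant vector outside: `SLet : ∀ i, … → SockLettersRD L BG BR B₀′H B₂′ cL i.η i.k i.Ω i.Λs` (p619291).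
dag-n05-w2's p623323 inhabits the TEXT at the one empty-tower member of depth `k = 1`, with `BG = 2L∕η²`, `B₀′H = 2L` — constants that vary with the member's spacing `η` (witness
`g = id`), so even the restriction of `SLet` to the `k = 1` empty towers `{(η, 1, (ℤᵈ, ∅, …))}_η` is not shown inhabited by it.  THIS FILE rescales the degenerate witness —
`g := η²·id`, `𝔄 := η⁻²·id − Δ^η_{U₀}` (level `0`), `C := η⁻⁴·id`, `H′ :=` evaluation at level `0` — so that every bound clause holds with MEMBER-FREE constants `(2, 0, 2, 4d)`
at EVERY empty-tower member (every `η > 0`, every depth `k`, every truncation `n ≤ k`: the weighted norms `(Lʲη)`-weights are read at `j = 0` only, all higher regions being empty),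
for every unitary `U₀` (no small-field input used) and any threshold: the binder `SLet` RESTRICTED TO THE EMPTY-TOWER SUB-CLASS is INHABITED.  WITNESS DEGENERATE and declared: it
certifies the consistency of the letter TEXT with uniform constants on an infinite sub-class of the (1.5)-obeying index; nothing of [4] Thm 3.1's operators (`G′`, `Q′G′²Q′ᵀ`) is
built; the binder over ALL members stays N06 content.

## WHAT IS PROVED (kernel, 0 sorry, 0 def)

* §1 ★★ `sockLettersRD_emptyTower_uniform` — generic: any `L`, `η > 0`, any depth `k`, `Ω 0 = ℤᵈ`, `Ω j = ∅` (`j ≥ 1`), `Λs n 0 = ℤᵈ` and `Λs n j = ∅` (`1 ≤ j`) for the truncations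
  `1 ≤ n ≤ k` ⊢ `SockLettersRD L 2 0 2 (4d) cP η k Ω Λs`.
* §2 ★★ `sockLettersRD_of_lamTop_emptyTower` — at the BINDER SHAPE: a lawful (`IdxB8Laws`), (1.3)–(1.4)-admissible member with the (1.5) face whose domains are the empty tower
  (`i.Ω 0 = univ`, `i.Ω j = ∅` for `j ≥ 1`) satisfies `SockLettersRD L 2 0 2 (4d) cP i.η i.k i.Ω i.Λs` — its constraint families are forced by rigidity
  (`B8IdxB8SubDRigidity.Λs_eq_lam_of_lamTop`); ★ `sLet_restricted_emptyTowerClass` (p619291's literal binder prefix, restricted to the sub-class, DISCHARGED with one constant vector).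
* §3 `IdxB8SubD.sockLettersRD_of_emptyTower` (index of record) · `exists_idxB8SubD_emptyTower_depth` (the sub-class has a member at every depth `k ≥ 1` and admissible spacing).

## HONEST SCOPE

A CONSISTENCY certificate for a hypothesis TEXT on an infinite but THIN sub-class (no averaging constraint above level `0`: `Q′ = id`), by a degenerate witness; NO estimate;
nothing of [B8] ∕ [4] asserted; the five (1.5)-keyed families of the N05 road remain HYPOTHESES (N06 content); WATCH-P2D-SLET-INHABITATION is advanced only to «the ∀-binder's shape
is respected on a sub-class».  Count-neutral; N05 NOT discharged; `T_η ↦ ℤᵈ`; one finite `𝕋⁴` programme at fixed `ε`, Bałaban as printed — the Yang–Mills mass gap (Clay) is NOT proved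
by any of this; R4 closes the conditional finite-`𝕋⁴` rung `BalabanLadder.UV` only; nothing continuum ∕ ℝ⁴ ∕ OS.  No `sorry`, no `def`, no `instance`, no `notation`.
Unit `pub-ymgap-dag-n05-w1` (g3), 2026-08-28.  RELATED, USED BY NAME: `B8SockLettersRDEmptyTowerInhabited` (dag-n05-w2 g4: the `k = 1` member, the pinned-letter readings, the
norm lemmas' use), `B8IdxB8SubDRigidity` (dag-n05-w2: universality ∕ rigidity), `B8IdxB8LamTopTowerDisjoint` (dag-n05-c), `B8SockLettersRD` (dag-n05-d: the text).

[cite: Balaban1985RegularSpaces, (1.3)–(1.6) p.77, (1.91)–(1.92) p.91, (1.95)–(1.98) p.92, (1.101) p.93, (1.107) p.94; Balaban1985BackgroundPropagators, Thm 3.1 p.397, (3.16) p.393, (3.23)–(3.25) p.394]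
-/

noncomputable section

open NormedSpace

namespace Literature.MathematicalPhysics.QuantumFieldTheory.Balaban1983to89.B8SockLettersRDEmptyTowerClassUniform

open B7Prop1Explicit B7Prop1Local
open B7Prop2Explicit (unitaryUnits unitaryUnits_le_U1)
open B7Eq78Linearization (zdBlocking QprimeIter)
open B8Ineq132 (covDerivFwd InAk)
open B8Eq119TwistedAxial (bgT)
open B8Eq140Level (SideTouches)
open B8Eq138LandauZd (covLap QT QprimeT QprimeT_zero)
open B8Eq1117Concrete (XSpace)
open B8Prop5ContractionKLevel (Bd2)
open B8LambdaSpaceKLevel (wt)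
open B8LeafModelZd (ZdIdx)
open B8ConstraintBonds (DomainSeq Lam)
open B8IdxB8LawsB (IdxB8LawsB)
open B8SockLettersRD (SockLettersRD)
open B9SupplySockB9P3ZdLettersOmega (norm_covDerivFwd_le norm_covLap_le covLap_add)
open B8Prop5JoinSectE (covLap_smul)
open B8IdxB8SubDRigidity (exists_idxB8SubD_of_domainSeq mem_lamK_iff_of_lt mem_lamK_self_iff Λs_eq_lam_of_lamTop)
open B8Eq131DomainSeq (isLevel_pow_smul)
open B8SockLettersRDEmptyTowerInhabited (domainSeq_emptyTower)
open Node00 (Stage3Params IdxB8Laws IdxB8SubD)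

-- `Site` alone could resolve to the torus sites of `Setup.lean`; re-export the `ℤ^d` sites of `B7Prop1Explicit`.
export B7Prop1Explicit (Site)

variable {d : ℕ}

/-! ## §1 The rescaled degenerate witness on the whole empty-tower sub-class -/

section Letters

variable {𝔸 : Type*} [CStarAlgebra 𝔸] [Nontrivial 𝔸]

/-- No plaquette touches the empty region, so no bond side-touches it (private plumbing). [cite: Balaban1985RegularSpaces, p.77 (convention before (1.5))] -/
private theorem not_sideTouches_empty (y : Site d) (τ : Fin d) : ¬ SideTouches (∅ : Set (Site d)) y τ := by
  rintro ⟨z, κ, ν, -, hp, -⟩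
  simp [B8Ineq132.PlaqTouches] at hp

/-- ★★ **`SockLettersRD` ON THE WHOLE EMPTY-TOWER SUB-CLASS WITH ONE CONSTANT VECTOR `(B_G, B_R, B₀′_H, B₂′) = (2, 0, 2, 4d)`**: for every `L`, every spacing `η > 0`, every depth `k`,
domains `Ω 0 = ℤᵈ`, `Ω j = ∅` (`j ≥ 1`) and constraint families with `Λs n 0 = ℤᵈ`, `Λs n j = ∅` (`1 ≤ j ≤ n`) at every truncation `1 ≤ n ≤ k`, every threshold `cP`; inside: every
`α₀`, every unitary `U₀` (no small field used), every `n`.  Witness (DEGENERATE, declared): `g := η²·id`, `Δ := Δ^η_{U₀}`, `q := ` the level-`0` embedding, `qs := ` the level-`0`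
reading, `𝔄 := q ∘ (η⁻²·id − Δ) ∘ qs`, `C := η⁻⁴·id`, `H′X := X(0, ·)`; all weights are read at level `0` (`wt L η 0 = η`), which is what makes the constants `η`-free.
[cite: Balaban1985BackgroundPropagators, Thm 3.1 p.397, (3.16) p.393, (3.23)–(3.25) p.394; Balaban1985RegularSpaces, (1.91)–(1.92) p.91, (1.95)–(1.98) p.92, (1.101) p.93, (1.107) p.94] -/
theorem sockLettersRD_emptyTower_uniform {L : ℕ} {η : ℝ} (hη : 0 < η) {k : ℕ} {Ω : ℕ → Set (Site d)} {Λs : ℕ → ℕ → Set (Site d)}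
    (hΩ0 : Ω 0 = Set.univ) (hΩ : ∀ j, 1 ≤ j → Ω j = ∅) (hΛ0 : ∀ n, 1 ≤ n → n ≤ k → Λs n 0 = Set.univ)
    (hΛ : ∀ n j, 1 ≤ n → n ≤ k → 1 ≤ j → j ≤ n → Λs n j = ∅) (cP : ℝ) :
    SockLettersRD (𝔸 := 𝔸) L 2 0 2 (4 * d) cP η k Ω Λs := by
  intro α₀ _ _ U₀ hU₀ _ n hn1 hnk
  have hΛe : ∀ j, 1 ≤ j → j ≤ n → Λs n j = ∅ := fun j hj hjn => hΛ n j hn1 hnk hj hjn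
  have hU1 : ∀ x κ, U₀ x κ ∈ U1 𝔸 := fun x κ => unitaryUnits_le_U1 (hU₀ x κ)
  have hη0 : η ≠ 0 := hη.ne'
  have hη2 : 0 < η ^ 2 := by positivity
  have hΛn0 : Λs n 0 = Set.univ := hΛ0 n hn1 hnk
  -- the scalars of the rescaling, as complex numbers: `s = η²`, `t = η⁻²`
  set s : ℂ := ((η ^ 2 : ℝ) : ℂ) with hs
  have hs0 : s ≠ 0 := by rw [hs]; exact_mod_cast hη2.ne'
  set t : ℂ := s⁻¹ with ht
  have hts : t * s = 1 := inv_mul_cancel₀ hs0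
  have hst : s * t = 1 := mul_inv_cancel₀ hs0
  have hnorm_s : ‖s‖ = η ^ 2 := by rw [hs, Complex.norm_real, Real.norm_eq_abs, abs_of_pos hη2]
  -- the letters
  let Δ : (Site d → 𝔸) →ₗ[ℂ] (Site d → 𝔸) :=
    { toFun := fun f x => covLap η U₀ f x
      map_add' := fun f g => funext fun x => covLap_add η U₀ f g x
      map_smul' := fun c f => funext fun x => by
        simp only [RingHom.id_apply, Pi.smul_apply]; exact covLap_smul η U₀ c f x }
  let g : (Site d → 𝔸) →ₗ[ℂ] (Site d → 𝔸) := s • LinearMap.id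
  let c : (ℕ → Site d → 𝔸) →ₗ[ℂ] (ℕ → Site d → 𝔸) := (t * t) • LinearMap.id
  let q : (Site d → 𝔸) →ₗ[ℂ] (ℕ → Site d → 𝔸) := LinearMap.single ℂ (fun _ : ℕ => Site d → 𝔸) 0
  let qs : (ℕ → Site d → 𝔸) →ₗ[ℂ] (Site d → 𝔸) := LinearMap.proj 0
  let Aw : (ℕ → Site d → 𝔸) →ₗ[ℂ] (ℕ → Site d → 𝔸) := q ∘ₗ (t • LinearMap.id - Δ) ∘ₗ qs
  let H' : XSpace d n 𝔸 →ₗ[ℂ] (Site d → 𝔸) :=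
    { toFun := fun X x => X ((0 : Fin (n + 1)), x)
      map_add' := fun X Y => funext fun x => by simp
      map_smul' := fun c X => funext fun x => by simp }
  have hΔ : ∀ f x, Δ f x = covLap η U₀ f x := fun _ _ => rfl
  have hg : ∀ f, g f = s • f := fun _ => rfl
  have hc : ∀ μ, c μ = (t * t) • μ := fun _ => rfl
  have hq : ∀ f, q f = Pi.single (0 : ℕ) f := fun _ => rfl
  have hq0 : ∀ f, q f 0 = f := fun f => by rw [hq, Pi.single_eq_same]
  have hqj : ∀ f j, j ≠ 0 → q f j = 0 := fun f j hj => by rw [hq, Pi.single_eq_of_ne hj]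
  have hqs : ∀ μ, qs μ = μ 0 := fun _ => rfl
  have hqsq : ∀ f, qs (q f) = f := fun f => by rw [hqs, hq0]
  have hH : ∀ (X : XSpace d n 𝔸) x, H' X x = X (0, x) := fun _ _ => rfl
  have hHn : ∀ (X : XSpace d n 𝔸) x, ‖H' X x‖ ≤ ‖X‖ := fun X x => by rw [hH]; exact X.norm_coe_le_norm (0, x)
  -- `g g qs c q = id` and `g qs c q g = id` (the rescalings cancel)
  have hsc : ∀ (a : ℂ) (v : Site d → 𝔸), a = 1 → a • v = v := fun a v ha => by rw [ha, one_smul]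
  have hggc : ∀ f, g (g (qs (c (q f)))) = f := fun f => by
    have h1 : qs (c (q f)) = (t * t) • f := by rw [hc, map_smul, hqsq]
    rw [h1, hg, hg, smul_smul, smul_smul]
    exact hsc _ _ (by rw [ht]; field_simp)
  have hgcg : ∀ f, g (qs (c (q (g f)))) = f := fun f => by
    have h1 : qs (c (q (g f))) = (t * t * s) • f := by rw [hg f, map_smul, hc, smul_smul, map_smul, hqsq]
    rw [h1, hg, smul_smul]
    exact hsc _ _ (by rw [ht]; field_simp)
  -- the level-`0` sup bounds behind every bound clause
  have hder : ∀ (f : Site d → 𝔸) (r : ℝ), (∀ y, ‖f y‖ ≤ r) → ∀ (x : Site d) (κ : Fin d), wt L η 0 * ‖covDerivFwd η U₀ κ f x‖ ≤ 2 * r := by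
    intro f r hr x κ
    have h1 : ‖covDerivFwd η U₀ κ f x‖ ≤ η⁻¹ * (2 * r) :=
      (norm_covDerivFwd_le hη (hU1 x κ) f).trans (mul_le_mul_of_nonneg_left (by linarith [hr (x + e κ), hr x]) (inv_nonneg.mpr hη.le))
    simp only [wt, pow_zero, one_mul]
    calc η * ‖covDerivFwd η U₀ κ f x‖ ≤ η * (η⁻¹ * (2 * r)) := mul_le_mul_of_nonneg_left h1 hη.le
      _ = 2 * r := by field_simp
  have hlap : ∀ (f : Site d → 𝔸) (r : ℝ), (∀ y, ‖f y‖ ≤ r) → ∀ x : Site d, wt L η 0 ^ 2 * ‖covLap η U₀ f x‖ ≤ 4 * d * r := by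
    intro f r hr x
    have h := norm_covLap_le hη hU1 hr x
    simp only [wt, pow_zero, one_mul]
    calc η ^ 2 * ‖covLap η U₀ f x‖ ≤ η ^ 2 * (4 * d * (η⁻¹ * (η⁻¹ * r))) := mul_le_mul_of_nonneg_left h hη2.le
      _ = 4 * d * r := by field_simp
  -- a `Bd2`-bounded `f` at an empty-tower member has `‖g f‖ ≤ r` (the point of the rescaling)
  have hBd : ∀ (f : Site d → 𝔸) (r : ℝ), Bd2 L η n Ω f r → ∀ y, ‖g f y‖ ≤ r := by
    intro f r hf y
    have h := hf 0 (Nat.zero_le n) y (by rw [hΩ0]; exact Set.mem_univ y)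
    simp only [wt, pow_zero, one_mul] at h
    rw [hg, Pi.smul_apply, norm_smul, hnorm_s]
    exact h
  -- side-touching is a level-`0` affair at an empty-tower member
  have hside : ∀ j, j ≤ n → ∀ (p : Site d × Fin d), SideTouches (Ω j) p.1 p.2 → j = 0 := by
    intro j _ p hp
    by_contra hj
    rw [hΩ j (Nat.one_le_iff_ne_zero.mpr hj)] at hp
    exact not_sideTouches_empty p.1 p.2 hp
  refine ⟨g, Δ, q, qs, Aw, c, H', ?_, ?_, ?_, ?_, ?_, ?_, ?_, ?_, ?_, ?_, ?_, ?_, ?_, ?_, ?_, ?_⟩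
  · -- (1) `Δ g x + qs 𝔄 q (g x) = x`: `𝔄` absorbs `−Δ` and `η⁻²·η² = 1`
    intro x y _
    have h1 : qs (Aw (q (g x))) = t • (g x) - Δ (g x) := by
      simp only [Aw, LinearMap.comp_apply, hqsq, LinearMap.sub_apply, LinearMap.smul_apply, LinearMap.id_apply]
    rw [Pi.add_apply, h1, Pi.sub_apply, hg, Pi.smul_apply, Pi.smul_apply, smul_smul, hts, one_smul]
    abel
  · -- (2) the law of `C` on the range of `q`
    intro f
    rw [hggc]
  · -- (3) `Δ` is the covariant Laplacian on `Ω₀ = ℤᵈ`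
    intro f x _
    rw [hΔ, hΩ0, Set.indicator_univ]
  · -- (4) `qs = Q′ᵀ` at the tower: only the level-`0` family `Λs n 0 = ℤᵈ` is non-empty, and `Q′₀ᵀ = id`
    intro μ x _
    rw [hqs, QT, Finset.sum_eq_single 0 (fun j _ hj => ?_) (fun h => absurd (Finset.mem_range.mpr (Nat.succ_pos n)) h), hΛn0, Set.indicator_univ]
    · rfl
    · rename_i hjr
      rw [hΛe j (Nat.one_le_iff_ne_zero.mpr hj) (Nat.lt_succ_iff.mp (Finset.mem_range.mp hjr)), Set.indicator_empty]; exact QprimeT_zero L U₀ j x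
  · -- (5) `q = Q′` at the tower sites (level `0`: `Q′₀ = id`; higher levels empty)
    intro f j hj y hy
    rcases Nat.eq_zero_or_pos j with rfl | hjp
    · rw [hq0]; rfl
    · rw [hΛe j hjp hj] at hy; exact absurd hy (Set.notMem_empty y)
  · -- (6) `‖H′X‖ ≤ 2‖X‖`
    intro X x
    exact (hHn X x).trans (le_mul_of_one_le_left (norm_nonneg X) (by norm_num))
  · -- (7) weighted covariant derivatives of `H′X` (level `0` only)
    intro j hj X p hp
    obtain rfl := hside j hj p hp
    exact hder (H' X) ‖X‖ (hHn X) p.1 p.2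
  · -- (8) `Bd2` of the Laplacian of `H′X` (level `0` only)
    intro X j hj x hx
    rcases Nat.eq_zero_or_pos j with rfl | hjp
    · exact hlap (H' X) ‖X‖ (hHn X) x
    · rw [hΩ j hjp] at hx; exact absurd hx (Set.notMem_empty x)
  · -- (9) `H′X = 0` off `Ω₀ = ℤᵈ` (vacuous)
    intro X x hx
    rw [hΩ0] at hx; exact absurd (Set.mem_univ x) hx
  · -- (10) reality of `H′`
    intro X Y hXY x
    rw [hH, hH, hXY]
  · -- (11) interpolation: `Q′₀(H′Y) = Y(0, ·)`, higher levels empty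
    intro Y j hj y hy
    rcases Nat.eq_zero_or_pos j with rfl | hjp
    · rfl
    · rw [hΛe j hjp hj] at hy; exact absurd hy (Set.notMem_empty y)
  · -- (12) bounds of `g = η²·id` under `Bd2` — member-free
    intro f r hr hf
    have hb := hBd f r hf
    refine ⟨fun x => (hb x).trans (by linarith), fun j hj p hp => ?_⟩
    obtain rfl := hside j hj p hp
    exact hder (g f) r hb p.1 p.2
  · -- (13) `g f = 0` off `Ω₀` (vacuous)
    intro f x hx
    rw [hΩ0] at hx; exact absurd (Set.mem_univ x) hx
  · -- (14) reality of `g = η²·id`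
    intro f hf x
    rw [hg, Pi.smul_apply, hs]
    exact (IsSelfAdjoint.smul (by simp [IsSelfAdjoint, Complex.conj_ofReal]) (hf 0 (Nat.zero_le n) x (by rw [hΩ0]; exact Set.mem_univ x)))
  · -- (15) the residual `f − g qs C q g f = 0`
    intro f r _ _ j _ x _
    rw [hgcg, sub_self, Pi.zero_apply, norm_zero, mul_zero, zero_mul]
  · -- (16) reality of the residual (it is `0`)
    intro f _ j _ x _
    rw [hgcg, sub_self, Pi.zero_apply]
    exact IsSelfAdjoint.zero _

end Letters

/-! ## §2 At the binder shape: lawful admissible (1.5)-members whose domains are the empty tower -/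

section Binder

variable {𝔸 : Type*} [CStarAlgebra 𝔸] [Nontrivial 𝔸]

/-- ★★ **AT THE BINDER SHAPE OF THE P₂D SLOT**: a member `i : ZdIdx d L` obeying the located laws `IdxB8Laws`, (1.3)–(1.4) `DomainSeq` and the (1.5) face, whose domains are the EMPTY
TOWER (`Ω₀ = ℤᵈ`, `Ω_j = ∅` for `j ≥ 1`), satisfies `SockLettersRD L 2 0 2 (4d) cP i.η i.k i.Ω i.Λs` for every `cP` — whatever its spacing and depth: its constraint families are forced
to `Λs n 0 = ℤᵈ`, `Λs n j = ∅` (`j ≥ 1`) by rigidity (`Λs_eq_lam_of_lamTop`). [cite: Balaban1985RegularSpaces, (1.3)–(1.6) p.77, (1.91)–(1.92) p.91, (1.101) p.93; Balaban1985BackgroundPropagators, Thm 3.1 p.397] -/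
theorem sockLettersRD_of_lamTop_emptyTower {L : ℕ} (hL : 1 ≤ L) (i : ZdIdx d L) (hlaws : IdxB8Laws L i) (hΩ : DomainSeq L i.Ω)
    (hΛ : ∀ j, j < i.k → ∀ z ∈ i.Λs i.k j, ((L : ℤ) ^ j) • z ∈ Lam L i.Ω j)
    (hΩ0 : i.Ω 0 = Set.univ) (hΩe : ∀ j, 1 ≤ j → i.Ω j = ∅) (cP : ℝ) :
    SockLettersRD (𝔸 := 𝔸) L 2 0 2 (4 * d) cP i.η i.k i.Ω i.Λs := by
  refine sockLettersRD_emptyTower_uniform i.hη hΩ0 hΩe (fun n hn1 hnk => ?_) (fun n j hn1 hnk hj hjn => ?_) cP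
  · rw [Λs_eq_lam_of_lamTop hL i hlaws hΩ hΛ hnk (Nat.zero_le n)]
    ext y
    rw [mem_lamK_iff_of_lt L i.Ω (by omega) y]
    simp only [Set.mem_univ, iff_true]
    refine ⟨isLevel_pow_smul L 0 y, by rw [hΩ0]; exact Set.mem_univ _, by rw [hΩe 1 le_rfl]; exact Set.notMem_empty _⟩
  · rw [Λs_eq_lam_of_lamTop hL i hlaws hΩ hΛ hnk hjn]
    ext y
    simp only [Set.mem_empty_iff_false, iff_false]
    rcases hjn.lt_or_eq with hlt | rfl
    · rw [mem_lamK_iff_of_lt L i.Ω hlt y]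
      exact fun h => by have h2 : ((L : ℤ) ^ j) • y ∈ i.Ω j := h.2.1; rw [hΩe j hj] at h2; exact h2
    · rw [mem_lamK_self_iff L i.Ω j y, hΩe j hj]
      exact Set.notMem_empty _

/-- ★ **p619291's BINDER `SLet`, RESTRICTED TO THE EMPTY-TOWER SUB-CLASS, IS DISCHARGED WITH ONE CONSTANT VECTOR**: the literal prefix `i.Ω 0 = univ → IdxB8LawsB L i →
DomainSeq L i.Ω → (∀ l < i.k, ∀ z ∈ i.Λs i.k l, Lˡ•z ∈ Lam L i.Ω l) → …` followed by the sub-class condition «`i.Ω j = ∅` for `j ≥ 1`» yields `SockLettersRD L 2 0 2 (4d) cP i.η i.k i.Ω i.Λs`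
for EVERY such member (every spacing, every depth). [cite: Balaban1985RegularSpaces, (1.3)–(1.6) p.77, (1.107) p.94; Balaban1985BackgroundPropagators, Thm 3.1 p.397] -/
theorem sLet_restricted_emptyTowerClass {L : ℕ} (hL : 1 ≤ L) (cP : ℝ) :
    ∀ i : ZdIdx d L, i.Ω 0 = Set.univ → IdxB8LawsB L i → DomainSeq L i.Ω →
      (∀ l, l < i.k → ∀ z ∈ i.Λs i.k l, ((L : ℤ) ^ l) • z ∈ Lam L i.Ω l) → (∀ j, 1 ≤ j → i.Ω j = ∅) →
      SockLettersRD (𝔸 := 𝔸) L 2 0 2 (4 * d) cP i.η i.k i.Ω i.Λs :=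
  fun i h0 hlaws hΩ hΛ hΩe => sockLettersRD_of_lamTop_emptyTower hL i hlaws.toIdxB8Laws hΩ hΛ h0 hΩe cP

end Binder

/-! ## §3 On the index of record: every depth, every admissible spacing -/

section Record

/-- **ON THE INDEX OF RECORD**: every member `j : IdxB8SubD θ` whose domains are the empty tower satisfies `SockLettersRD θ.L 2 0 2 (4·θ.D) cP j.η j.k j.Ω j.Λs`, every `cP`.
[cite: Balaban1985RegularSpaces, (1.3)–(1.6) p.77; Balaban1985BackgroundPropagators, Thm 3.1 p.397] -/
theorem IdxB8SubD.sockLettersRD_of_emptyTower {θ : Stage3Params} (j : IdxB8SubD θ) (hΩe : ∀ l, 1 ≤ l → j.1.1.1.1.Ω l = ∅) (cP : ℝ) :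
    SockLettersRD (𝔸 := θ.𝔸) θ.L 2 0 2 (4 * θ.D) cP j.1.1.1.1.η j.1.1.1.1.k j.1.1.1.1.Ω j.1.1.1.1.Λs :=
  sockLettersRD_of_lamTop_emptyTower (le_trans (by norm_num) θ.two_le_L) j.1.1.1.1 j.laws j.domainSeq j.lamTop j.Ω_zero hΩe cP

/-- **THE SUB-CLASS IS INHABITED AT EVERY DEPTH AND EVERY ADMISSIBLE SPACING**: for `k ≥ 1`, `0 < η`, `Lᵏη ≤ 1` there is `j : IdxB8SubD θ` with `j.k = k`, `j.η = η` and the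
empty tower as domains (dag-n05-w2's universality `exists_idxB8SubD_of_domainSeq` at `domainSeq_emptyTower`). [cite: Balaban1985RegularSpaces, (1.3)–(1.6) p.77, p.77 («Ω_j = T_η»)] -/
theorem exists_idxB8SubD_emptyTower_depth (θ : Stage3Params) {η : ℝ} (hη : 0 < η) {k : ℕ} (hk : 1 ≤ k) (hscale : (θ.L : ℝ) ^ k * η ≤ 1) :
    ∃ j : IdxB8SubD θ, j.1.1.1.1.k = k ∧ j.1.1.1.1.η = η ∧ (j.1.1.1.1.Ω = fun n => if n = 0 then Set.univ else ∅) := by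
  obtain ⟨j, hjη, hjk, hjΩ, -⟩ := exists_idxB8SubD_of_domainSeq θ hη hk hscale (Ω := fun n => if n = 0 then Set.univ else ∅) (if_pos rfl)
    (domainSeq_emptyTower θ.L)
  exact ⟨j, hjk, hjη, hjΩ⟩

/-- ★ **HENCE AT EVERY DEPTH THE INDEX OF RECORD CARRIES A MEMBER AT WHICH `SockLettersRD` HOLDS WITH THE CONSTANT VECTOR `(2, 0, 2, 4·D)`** (dag-n05-w2's `exists_idxB8SubD_sockLettersRD`
had depth `1`, spacing `L⁻¹`, `BG = 2L³`). [cite: Balaban1985RegularSpaces, (1.3)–(1.6) p.77; Balaban1985BackgroundPropagators, Thm 3.1 p.397] -/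
theorem exists_idxB8SubD_sockLettersRD_depth (θ : Stage3Params) {k : ℕ} (hk : 1 ≤ k) (cP : ℝ) :
    ∃ j : IdxB8SubD θ, j.1.1.1.1.k = k ∧
      SockLettersRD (𝔸 := θ.𝔸) θ.L 2 0 2 (4 * θ.D) cP j.1.1.1.1.η j.1.1.1.1.k j.1.1.1.1.Ω j.1.1.1.1.Λs := by
  have hL : 1 ≤ θ.L := le_trans (by norm_num) θ.two_le_L
  have hL0 : (0 : ℝ) < θ.L := by exact_mod_cast (show 0 < θ.L by omega)
  have hη : (0 : ℝ) < ((θ.L : ℝ) ^ k)⁻¹ := by positivity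
  have hscale : (θ.L : ℝ) ^ k * ((θ.L : ℝ) ^ k)⁻¹ ≤ 1 := by rw [mul_inv_cancel₀ (by positivity)]
  obtain ⟨j, hjk, -, hjΩ⟩ := exists_idxB8SubD_emptyTower_depth θ hη hk hscale
  refine ⟨j, hjk, IdxB8SubD.sockLettersRD_of_emptyTower j (fun l hl => ?_) cP⟩
  rw [hjΩ]; exact if_neg (by omega)

end Record

end Literature.MathematicalPhysics.QuantumFieldTheory.Balaban1983to89.B8SockLettersRDEmptyTowerClassUniform

end
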